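/-
Copyright (c) 2026 the pub-hodgecm-mathlib formalisation cell (harness21).  Prover seat hodgecm-mathlib-K2Liu-p02 (g2),
Track B «K2-LIT» ∕ hLiu418 #184♮, unit U6 «FIRST TERM», socket #42R (steward): right translation and `K`-finiteness of the Siegel–Weil
section of the trivial line (★ DEFS leaf O42.3a `K2Lit/SiegelWeilSectionLine`, p856173).  2026-09-04.
-/
import Literature.NumberTheory.K2Lit.SiegelWeilSectionLine        -- ★ p856173: `swSection`, `isSiegelDeltaSection_swSection`
import Literature.NumberTheory.K2Lit.SiegelStandardSections        -- ★ D1′: `IwasawaDatum`, `rightTranslateSpan`, `IsKFinite`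
import HarnessLib

/-!
# K2_Liu road (hLiu418 = stmt-HodgeConjecture-24832), unit U6: the Siegel–Weil section under RIGHT translation, and its `K`-finiteness
# from the `K`-finiteness of `Φ` under the Weil representation

Cell `pub/hodgecm-mathlib` (D-0151), Track B; steward file for socket #42R (K2Liu-p02 (g2)).  For the Siegel–Weil section
`f_Φ(h) = (ω(r_F(δ)·sD h)Φ)(0)` (★ `SiegelDoubled.swSection`): right translation by `k ∈ H(𝔸)` acts on `Φ` through the Weil representation,
`f_Φ(h k) = f_{ω(sD k)Φ}(h)` (`swSection_mul_right`, `sD` a homomorphism and `ω` a representation), and `Φ ↦ f_Φ` is `ℂ`-linear (★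
`swSection_add ∕ _smul`); hence if `Φ` is `K`-FINITE for `ω ∘ sD` — the span of `{ω(sD k)Φ : k ∈ K}` is finite-dimensional, the printed
«`K`-finite Schwartz function» [KudlaRallis1994 §1; HarrisKudlaSweet1996 (1.16)] — then `f_Φ` is `K`-finite in the sense of ★ `IsKFinite 𝒦`
(`isKFinite_swSection`): the right `K`-translates of `f_Φ` lie in the image of that span under the linear map `Ψ ↦ f_Ψ`.  With ★
`isSiegelDeltaSection_swSection` and the standard extension (DEFS leaf O42.3d `K2Lit/SiegelStandardExtension`, p856298) this makes the Siegel–Weil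
FAMILY of a `K`-finite `Φ` a STANDARD family — the class every socket of the road quantifies over.

* `swSection_mul_right` — `f_Φ(h·k) = f_{ω(sD k)Φ}(h)`.
* `swSectionₗ` is not introduced (no defs in a Theorems helper): linearity is used through ★ `swSection_add ∕ _smul` inside the proof.
* **`isKFinite_swSection`** — `FiniteDimensional ℂ (span {ω(sD k)Φ : k ∈ K}) → IsKFinite 𝒦 (swSection sD Φ)`.

Mathlib + ★ only; no `sorry`, no definition, no instance.  HONEST LABEL: HC_CM is proved only modulo the 7 printed citations (2 remaining named
inputs: hLiu418 = stmt-HodgeConjecture-24832, h413 = stmt-HodgeConjecture-24833) until rung 0 closes; this file is a `--supports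
stmt-HodgeConjecture-24832 --as helper` file and retires nothing by itself.

References: [KudlaRallis1994] S. Kudla, S. Rallis, Ann. of Math. 140 (1994) §1; [HarrisKudlaSweet1996] §1 (1.15)–(1.17); [Tan1999] §1.
-/

set_option autoImplicit false
set_option linter.dupNamespace false
-- the doubled metaplectic carrier `Mp(𝕎^𝔻)ᶜᵒⁿᵗ` elaborates slowly (cf. ★ `SiegelWeilSectionLine`): term-mode chains, generous heartbeats
set_option maxHeartbeats 2000000

noncomputable section

open NumberField IsDedekindDomain
open scoped Matrix

namespace Summit.HodgeConjecture.HodgeConjecture.Cruxes.HLiu418.K2LiuSiegelWeilSectionKFinite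

open Literature.NumberTheory.Automorphic Literature.NumberTheory.GaloisRepresentations
open Literature.NumberTheory.GelbartRogawski1991 Literature.NumberTheory.GelbartRogawski1991.GRConstruction
open Literature.NumberTheory.Weil1964
open Literature.NumberTheory.K2Lit.SiegelDoubled

variable (L : Type) [Field L] [NumberField L] [IsCMField L]
variable {N M n : ℕ} (e : Fin N × Fin M ≃ Fin n)
  (dV : Fin N → L) (hdV : ∀ i, IsCMField.complexConj L (dV i) = dV i) (hdV0 : ∀ i, dV i ≠ 0)
  (dW : Fin M → L) (hdW : ∀ i, IsCMField.complexConj L (dW i) = dW i) (hdW0 : ∀ i, dW i ≠ 0)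

/-- **Right translation acts on `Φ` through the Weil representation**: `f_Φ(h·k) = f_{ω(sD k)Φ}(h)` (`sD` is a homomorphism, `ω` a representation).
[cite: KudlaRallis1994, §1] [cite: HarrisKudlaSweet1996, §1 (1.16)] -/
theorem swSection_mul_right (sD : HA L e dV hdV dW hdW →* MpD L e dV hdV dW hdW) (Φ : piSchwartzBruhat (Fp L) (Fin (n + n)))
    (h k : HA L e dV hdV dW hdW) :
    swSection L e dV hdV hdV0 dW hdW hdW0 sD Φ (h * k) =
      swSection L e dV hdV hdV0 dW hdW hdW0 sD
        (adelicMpCont.omega (Fp L) (Fin (n + n)) (gramDA L e dV hdV dW hdW) (sD k) Φ) h := by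
  -- `r(δ)·sD(h k) = (r(δ)·sD h)·sD k`
  have hmul := MonoidHom.map_mul sD h k
  have hassoc := mul_assoc (rDelta L e dV hdV hdV0 dW hdW hdW0) (sD h) (sD k)
  have hfac := (congrArg (rDelta L e dV hdV hdV0 dW hdW hdW0 * ·) hmul).trans hassoc.symm
  -- `ω(q·q′)Φ = ω(q)(ω(q′)Φ)`
  have hop := LinearMap.congr_fun
    ((adelicMpCont.omega (Fp L) (Fin (n + n)) (gramDA L e dV hdV dW hdW)).map_mul (rDelta L e dV hdV hdV0 dW hdW hdW0 * sD h) (sD k)) Φ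
  unfold swSection
  exact (congrArg (fun q => opD L e dV hdV dW hdW q Φ 0) hfac).trans
    (congrArg (fun T : piSchwartzBruhat (Fp L) (Fin (n + n)) => (T : (Fin (n + n) → AdeleRing (𝓞 (Fp L)) (Fp L)) → ℂ) 0) hop)

/-- **`K`-FINITENESS OF THE SIEGEL–WEIL SECTION**: if the span of `{ω(sD k)Φ : k ∈ K}` is finite-dimensional (`Φ` is `K`-finite for the Weil
representation pulled back along `sD`), then `f_Φ = swSection sD Φ` is `K`-finite for the Iwasawa datum `𝒦` (★ `IsKFinite 𝒦`): its right
`K`-translates are the sections `f_{ω(sD k)Φ}`, which lie in the image of that span under the `ℂ`-linear map `Ψ ↦ f_Ψ`.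
[cite: KudlaRallis1994, §1] [cite: HarrisKudlaSweet1996, §1 (1.16)] [cite: Tan1999, §1] -/
theorem isKFinite_swSection (𝒦 : IwasawaDatum L e dV hdV dW hdW) (sD : HA L e dV hdV dW hdW →* MpD L e dV hdV dW hdW)
    (Φ : piSchwartzBruhat (Fp L) (Fin (n + n)))
    (hΦ : FiniteDimensional ℂ (Submodule.span ℂ (Set.range fun k : 𝒦.K =>
      adelicMpCont.omega (Fp L) (Fin (n + n)) (gramDA L e dV hdV dW hdW) (sD (k : HA L e dV hdV dW hdW)) Φ))) :
    Literature.NumberTheory.K2Lit.SiegelDoubled.IsKFinite 𝒦 (swSection L e dV hdV hdV0 dW hdW hdW0 sD Φ) := by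
  -- the `ℂ`-linear map `Ψ ↦ f_Ψ`
  let F : piSchwartzBruhat (Fp L) (Fin (n + n)) →ₗ[ℂ] (HA L e dV hdV dW hdW → ℂ) :=
    { toFun := fun Ψ => swSection L e dV hdV hdV0 dW hdW hdW0 sD Ψ
      map_add' := fun Ψ Ψ' => funext fun h => swSection_add L e dV hdV hdV0 dW hdW hdW0 sD Ψ Ψ' h
      map_smul' := fun c Ψ => funext fun h => swSection_smul L e dV hdV hdV0 dW hdW hdW0 sD c Ψ h }
  have hF : ∀ Ψ, F Ψ = swSection L e dV hdV hdV0 dW hdW hdW0 sD Ψ := fun _ => rfl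
  have hle : rightTranslateSpan 𝒦 (swSection L e dV hdV hdV0 dW hdW hdW0 sD Φ) ≤
      (Submodule.span ℂ (Set.range fun k : 𝒦.K =>
        adelicMpCont.omega (Fp L) (Fin (n + n)) (gramDA L e dV hdV dW hdW) (sD (k : HA L e dV hdV dW hdW)) Φ)).map F := by
    refine Submodule.span_le.2 ?_
    rintro _ ⟨k, rfl⟩
    refine ⟨adelicMpCont.omega (Fp L) (Fin (n + n)) (gramDA L e dV hdV dW hdW) (sD (k : HA L e dV hdV dW hdW)) Φ,
      Submodule.subset_span ⟨k, rfl⟩, ?_⟩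
    rw [hF]
    exact funext fun h => (swSection_mul_right L e dV hdV hdV0 dW hdW hdW0 sD Φ h k).symm
  unfold Literature.NumberTheory.K2Lit.SiegelDoubled.IsKFinite
  haveI := hΦ
  exact Submodule.finiteDimensional_of_le hle

end Summit.HodgeConjecture.HodgeConjecture.Cruxes.HLiu418.K2LiuSiegelWeilSectionKFinite

end
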